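import Summits.KontsevichZagierPeriods.KontsevichZagierPeriods.Theses.SymplecticScissors
import Literature.NumberTheory.Transcendental.SemialgebraicMapsProofs

/-!
# `StackingShear` (stmt-KontsevichZagierPeriods-9854, route SymplecticScissors)

The support item `StackingShear` of route `SymplecticScissors`: for `ℚ`-semialgebraic `f, g ≥ 0` on
`(a, b)` with `f` of class `C¹`, the subgraph of `f + g` equals, in the planar set-chain group
`closure ((domainAddRel ∪ changeOfVariablesRel) ∩ closure {[s] : s planar, integrand 1})`, the
subgraph of `f` plus the subgraph of `g`.

Proof (the four-move chain checked by the refuters, notes on the item): with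
`B := r.domain \ r₁.domain = {x ∈ (a,b), f x ≤ y < f x + g x, 0 < y}`,

1. rule (1a): `[r] − [r₁] − [r|_B]` (disjoint union; needs `g ≥ 0` for `r₁.domain ⊆ r.domain`);
2. rule (2): the vertical shear `Φ (x, y) = (x, y − f x)` (semialgebraic, `C¹`, injective,
   `det DΦ = 1`) carries `r|_B` to the integrand-`1` representation `r'` on `Φ '' B`
   (`exists_shear_move`, finite area by the Jacobian formula);
3. rule (1a): `[r'] − [r₂] − [r'|_N]`, `N := Φ '' B \ r₂.domain` (needs `f ≥ 0` for
   `r₂.domain ⊆ Φ '' B`);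
4. rule (1a): `[r'|_N] − [r'|_N] − [r'|_N]`, legitimate because `N ⊆ {y = 0}` is Lebesgue-null, so
   `[r'|_N] ≡ 0`.

Every representation met is planar with integrand `1`, so each move lies in the intersected
generating set. Sources: Kontsevich–Zagier 2001, §1.2 (rules 1a, 2); Bochnak–Coste–Roy 1998, §2.2
(semialgebraic maps, Tarski–Seidenberg: `SemialgebraicMapsProofs`); Mathlib's Jacobian formula
`MeasureTheory.lintegral_abs_det_fderiv_eq_addHaar_image`.
-/

noncomputable section

open Set MeasureTheory
open Literature.NumberTheory.Transcendental
open Literature.ModelTheory.ExponentialFields (IsSemialgebraic)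

namespace Summit.KontsevichZagierPeriods.SymplecticScissors.StackingShear

/-- The coordinate hyperplane `{y = 0}` of the plane is Lebesgue-null (a strict subspace has Haar
measure zero, `MeasureTheory.Measure.addHaar_submodule`). [folklore] -/
theorem volume_setOf_apply_one_eq_zero : volume {q : Fin 2 → ℝ | q 1 = 0} = 0 := by
  have h : ({q : Fin 2 → ℝ | q 1 = 0} : Set (Fin 2 → ℝ)) =
      ((LinearMap.ker (LinearMap.proj 1 : (Fin 2 → ℝ) →ₗ[ℝ] ℝ) : Submodule ℝ (Fin 2 → ℝ)) :
        Set (Fin 2 → ℝ)) := by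
    ext q
    simp
  rw [h]
  refine Measure.addHaar_submodule volume _ fun htop => ?_
  have hmem : (Pi.single 1 1 : Fin 2 → ℝ) ∈
      LinearMap.ker (LinearMap.proj 1 : (Fin 2 → ℝ) →ₗ[ℝ] ℝ) := htop ▸ Submodule.mem_top
  simp at hmem

/-- The derivative `(u, v) ↦ (u, v − c u)` of a vertical shear has determinant `1`. [folklore] -/
theorem det_shearDeriv (c : ℝ) :
    (ContinuousLinearMap.pi ![ContinuousLinearMap.proj 0,
        ContinuousLinearMap.proj 1 - c • ContinuousLinearMap.proj 0] :
      (Fin 2 → ℝ) →L[ℝ] (Fin 2 → ℝ)).det = 1 := by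
  unfold ContinuousLinearMap.det
  rw [← LinearMap.det_toMatrix', Matrix.det_fin_two]
  simp [LinearMap.toMatrix'_apply]

/-- The vertical shear `(x, y) ↦ (x, y − f x)` has derivative `(u, v) ↦ (u, v − f′(x) u)` at every
point over which `f` is differentiable. [folklore] -/
theorem hasFDerivAt_shear {f : ℝ → ℝ} {f' : ℝ} {p : Fin 2 → ℝ} (hf : HasDerivAt f f' (p 0)) :
    HasFDerivAt (fun q : Fin 2 → ℝ => (![q 0, q 1 - f (q 0)] : Fin 2 → ℝ))
      (ContinuousLinearMap.pi ![ContinuousLinearMap.proj 0,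
        ContinuousLinearMap.proj 1 - f' • ContinuousLinearMap.proj 0] :
        (Fin 2 → ℝ) →L[ℝ] (Fin 2 → ℝ)) p := by
  refine hasFDerivAt_pi'' fun i => ?_
  fin_cases i
  · simpa using hasFDerivAt_apply (𝕜 := ℝ) 0 p
  · simpa [Function.comp_def, Pi.sub_def] using
      (hasFDerivAt_apply (𝕜 := ℝ) 1 p).sub (hf.comp_hasFDerivAt p (hasFDerivAt_apply (𝕜 := ℝ) 0 p))

/-- The vertical shear `(x, y) ↦ (x, y − f x)` is a `ℚ`-semialgebraic map on every
`ℚ`-semialgebraic `B` lying over an interval on which `f` is `ℚ`-semialgebraic (composition and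
difference of semialgebraic functions; Tarski–Seidenberg). [Bochnak–Coste–Roy 1998, Prop. 2.2.6] -/
theorem isSemialgebraicMapOn_shear {a b : ℝ} {f : ℝ → ℝ}
    (hfs : IsSemialgebraicFunOn ℚ {z : Fin 1 → ℝ | z 0 ∈ Ioo a b} (fun z => f (z 0)))
    {B : Set (Fin 2 → ℝ)} (hB : IsSemialgebraic ℚ B) (hBsub : ∀ p ∈ B, p 0 ∈ Ioo a b) :
    IsSemialgebraicMapOn ℚ B (fun q : Fin 2 → ℝ => (![q 0, q 1 - f (q 0)] : Fin 2 → ℝ)) := by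
  -- `q ↦ f (q 0)` is semialgebraic on `B`: compose with the polynomial map `q ↦ (q 0)`
  have hπ : IsSemialgebraicMapOn ℚ B (fun (q : Fin 2 → ℝ) (_ : Fin 1) => q 0) := by
    simpa using isSemialgebraicMapOn_aeval hB
      (fun _ : Fin 1 => (MvPolynomial.X 0 : MvPolynomial (Fin 2) ℚ))
  have hf0 : IsSemialgebraicFunOn ℚ B (fun q : Fin 2 → ℝ => f (q 0)) :=
    IsSemialgebraicFunOn.comp_isSemialgebraicMapOn_holds hfs hπ fun q hq => hBsub q hq
  have h0 : IsSemialgebraicFunOn ℚ B (fun q : Fin 2 → ℝ => q 0) := by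
    simpa using isSemialgebraicFunOn_aeval hB (MvPolynomial.X 0 : MvPolynomial (Fin 2) ℚ)
  have h1 : IsSemialgebraicFunOn ℚ B (fun q : Fin 2 → ℝ => q 1) := by
    simpa using isSemialgebraicFunOn_aeval hB (MvPolynomial.X 1 : MvPolynomial (Fin 2) ℚ)
  have hsub : IsSemialgebraicFunOn ℚ B (fun q : Fin 2 → ℝ => q 1 - f (q 0)) :=
    IsSemialgebraicFunOn.sub_holds h1 hf0
  refine IsSemialgebraicMapOn.of_forall hB fun j => ?_
  fin_cases j
  · simpa using h0
  · simpa using hsub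

/-- **The shear move.** Let `f` be `ℚ`-semialgebraic and differentiable on `(a, b)` and let `r` be a
planar representation with integrand `1` whose domain lies over `(a, b)`. Then the vertical shear
`Φ (x, y) = (x, y − f x)` carries `r` to a planar representation `r'` with integrand `1` on
`Φ '' r.domain`, and `[r] − [r']` is ONE change-of-variables generator of the Kontsevich–Zagier
calculus (`Φ` semialgebraic, injective, `det DΦ = 1`; the image has finite area by the Jacobian
formula). [Kontsevich–Zagier 2001, §1.2, rule (2)] -/
theorem exists_shear_move {a b : ℝ} {f : ℝ → ℝ}
    (hfs : IsSemialgebraicFunOn ℚ {z : Fin 1 → ℝ | z 0 ∈ Ioo a b} (fun z => f (z 0)))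
    (hfd : DifferentiableOn ℝ f (Ioo a b)) (r : KZ.IntegralRep 2)
    (hr : ∀ p ∈ r.domain, p 0 ∈ Ioo a b) (hr1 : ∀ p ∈ r.domain, r.integrand p = 1) :
    ∃ r' : KZ.IntegralRep 2,
      r'.domain = (fun q : Fin 2 → ℝ => (![q 0, q 1 - f (q 0)] : Fin 2 → ℝ)) '' r.domain ∧
      (∀ q, r'.integrand q = 1) ∧ KZ.of r - KZ.of r' ∈ KZ.changeOfVariablesRel := by
  set Φ : (Fin 2 → ℝ) → (Fin 2 → ℝ) := fun q => (![q 0, q 1 - f (q 0)] : Fin 2 → ℝ) with hΦ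
  let Φ' : (Fin 2 → ℝ) → (Fin 2 → ℝ) →L[ℝ] (Fin 2 → ℝ) := fun p =>
    ContinuousLinearMap.pi ![ContinuousLinearMap.proj 0,
      ContinuousLinearMap.proj 1 - deriv f (p 0) • ContinuousLinearMap.proj 0]
  have hmeas : MeasurableSet r.domain := KZ.IntegralRep.measurableSet_domain_holds r
  have hsa : IsSemialgebraicMapOn ℚ r.domain Φ :=
    isSemialgebraicMapOn_shear hfs r.isSemialgebraic_domain hr
  have hderiv : ∀ p ∈ r.domain, HasFDerivWithinAt Φ (Φ' p) r.domain p := fun p hp =>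
    (hasFDerivAt_shear ((hfd.differentiableAt
      (Ioo_mem_nhds (hr p hp).1 (hr p hp).2)).hasDerivAt)).hasFDerivWithinAt
  have hinj : InjOn Φ r.domain := by
    intro p _ q _ hpq
    have h0 : p 0 = q 0 := by simpa [hΦ] using congr_fun hpq 0
    have h1 : p 1 - f (p 0) = q 1 - f (q 0) := by simpa [hΦ] using congr_fun hpq 1
    have h1' : p 1 = q 1 := by rw [h0] at h1; linarith
    ext i
    fin_cases i
    · simpa using h0
    · simpa using h1'
  have hdet : ∀ p, (Φ' p).det = 1 := fun p => det_shearDeriv _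
  have himg : IsSemialgebraic ℚ (Φ '' r.domain) :=
    IsSemialgebraicMapOn.isSemialgebraic_image_holds hsa Subset.rfl r.isSemialgebraic_domain
  -- finite area of the image: Jacobian formula with `|det| = 1`
  have hfin : volume (Φ '' r.domain) < ⊤ := by
    have hint1 : IntegrableOn (fun _ => (1 : ℝ)) r.domain := r.integrableOn.congr_fun hr1 hmeas
    have hvol : volume r.domain < ⊤ := by
      have := (integrableOn_const_iff).1 hint1
      simpa using this
    rw [← lintegral_abs_det_fderiv_eq_addHaar_image volume hmeas hderiv hinj]
    simpa [hdet] using hvol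
  let r' : KZ.IntegralRep 2 :=
    { domain := Φ '' r.domain
      integrand := fun _ => 1
      isSemialgebraic_domain := himg
      isSemialgebraicFunOn_integrand := by
        simpa using isSemialgebraicFunOn_aeval himg (1 : MvPolynomial (Fin 2) ℚ)
      integrableOn := integrableOn_const hfin.ne }
  refine ⟨r', rfl, fun _ => rfl, 2, r, r', Φ, Φ', hsa, hderiv, hinj, rfl, fun p hp => ?_, rfl⟩
  simp [r', hr1 p hp, hdet]

/-- Rule (1a) along a subdomain: if `r₁.domain ⊆ r.domain` and the integrands agree on `r₁.domain`,
then `[r] − [r₁] − [r|_(r.domain ∖ r₁.domain)]` is a domain-additivity generator (disjoint pieces).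
[Kontsevich–Zagier 2001, §1.2, rule (1)] -/
theorem sub_sub_restrict_diff_mem_domainAddRel {n : ℕ} (r r₁ : KZ.IntegralRep n)
    (hsub : r₁.domain ⊆ r.domain) (hint : EqOn r.integrand r₁.integrand r₁.domain) :
    KZ.of r - KZ.of r₁ -
        KZ.of (r.restrict (r.domain \ r₁.domain)
          (r.isSemialgebraic_domain.diff r₁.isSemialgebraic_domain) sdiff_subset) ∈
      KZ.domainAddRel :=
  ⟨n, r, r₁, r.restrict (r.domain \ r₁.domain)
      (r.isSemialgebraic_domain.diff r₁.isSemialgebraic_domain) sdiff_subset,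
    (union_sdiff_cancel hsub).symm, by simp, hint, fun _ _ => rfl, rfl⟩

/-- Rule (1a) on a null domain: if `r.domain` is Lebesgue-null then `[r] − [r] − [r]` is a
domain-additivity generator (`r.domain = r.domain ∪ r.domain` with null overlap), so `[r] ≡ 0` in
any quotient by the moves. [Kontsevich–Zagier 2001, §1.2, rule (1)] -/
theorem sub_self_sub_self_mem_domainAddRel {n : ℕ} (r : KZ.IntegralRep n)
    (h0 : volume r.domain = 0) : KZ.of r - KZ.of r - KZ.of r ∈ KZ.domainAddRel :=
  ⟨n, r, r, r, (union_self _).symm, by rwa [inter_self], fun _ _ => rfl, fun _ _ => rfl, rfl⟩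

/-- **`StackingShear`** (stmt-KontsevichZagierPeriods-9854). For `ℚ`-semialgebraic `f, g ≥ 0` on
`(a, b)` with `f` of class `C¹`, and planar integrand-`1` representations `r, r₁, r₂` of the
subgraphs of `f + g`, `f`, `g` over `(a, b)`, the element `[r] − [r₁] − [r₂]` lies in the planar
set-chain group `closure ((domainAddRel ∪ changeOfVariablesRel) ∩ closure {[s] : s planar,
integrand 1})`: cut along the graph of `f` (1a), shear the upper piece down by `f` (2), discard
the null segment `{y = 0}` (1a twice). [Kontsevich–Zagier 2001, §1.2, rules (1a), (2)] -/
theorem stackingShear_proof :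
    Summit.KontsevichZagierPeriods.KontsevichZagierPeriods.Theses.SymplecticScissors.StackingShear := by
  unfold Summit.KontsevichZagierPeriods.KontsevichZagierPeriods.Theses.SymplecticScissors.StackingShear
  intro a b f g _ hfs _ hfC hf0 hg0 r r₁ r₂ hr hr₁ hr₂ hri hr₁i hr₂i
  -- membership in the target subgroup, generator by generator
  have hH : ∀ s : KZ.IntegralRep 2, (∀ p ∈ s.domain, s.integrand p = 1) →
      KZ.of s ∈ AddSubgroup.closure {x : KZ.FormalRep | ∃ s : KZ.IntegralRep 2,
        (∀ p ∈ s.domain, s.integrand p = 1) ∧ x = KZ.of s} :=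
    fun s hs => AddSubgroup.subset_closure ⟨s, hs, rfl⟩
  have hG : ∀ x : KZ.FormalRep, x ∈ KZ.domainAddRel ∪ KZ.changeOfVariablesRel →
      x ∈ AddSubgroup.closure {x : KZ.FormalRep | ∃ s : KZ.IntegralRep 2,
        (∀ p ∈ s.domain, s.integrand p = 1) ∧ x = KZ.of s} →
      x ∈ AddSubgroup.closure ((KZ.domainAddRel ∪ KZ.changeOfVariablesRel) ∩
        (AddSubgroup.closure {x : KZ.FormalRep | ∃ s : KZ.IntegralRep 2,
          (∀ p ∈ s.domain, s.integrand p = 1) ∧ x = KZ.of s} : Set KZ.FormalRep)) :=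
    fun x h1 h2 => AddSubgroup.subset_closure ⟨h1, h2⟩
  -- Step 1 (1a): `r.domain = r₁.domain ⊔ B`, `B := r.domain \ r₁.domain`
  have h₁sub : r₁.domain ⊆ r.domain := by
    rw [hr, hr₁]
    rintro p ⟨hp0, hp1, hp2⟩
    exact ⟨hp0, hp1, hp2.trans_le (le_add_of_nonneg_right (hg0 _ hp0))⟩
  let rB : KZ.IntegralRep 2 := r.restrict (r.domain \ r₁.domain)
    (r.isSemialgebraic_domain.diff r₁.isSemialgebraic_domain) sdiff_subset
  have hrBi : ∀ p ∈ rB.domain, rB.integrand p = 1 := fun p hp => hri p hp.1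
  have hrB0 : ∀ p ∈ rB.domain, p 0 ∈ Ioo a b := fun p hp => by
    have hp' : p ∈ r.domain := hp.1
    rw [hr] at hp'
    exact hp'.1
  have hx₁ : KZ.of r - KZ.of r₁ - KZ.of rB ∈ KZ.domainAddRel :=
    sub_sub_restrict_diff_mem_domainAddRel r r₁ h₁sub fun p hp => by
      rw [hri p (h₁sub hp), hr₁i p hp]
  -- Step 2 (2): the shear `Φ (x, y) = (x, y - f x)` on `B`
  obtain ⟨r', hr'd, hr'i, hx₂⟩ :=
    exists_shear_move hfs (hfC.differentiableOn one_ne_zero) rB hrB0 hrBi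
  -- Step 3 (1a): `r'.domain = r₂.domain ⊔ N`, `N := r'.domain \ r₂.domain`
  have h₂sub : r₂.domain ⊆ r'.domain := by
    rw [hr'd, hr₂]
    rintro q ⟨hq0, hq1, hq2⟩
    have hf0q := hf0 _ hq0
    refine ⟨![q 0, q 1 + f (q 0)], ⟨?_, ?_⟩, ?_⟩
    · show (![q 0, q 1 + f (q 0)] : Fin 2 → ℝ) ∈ r.domain
      rw [hr]
      refine ⟨by simpa using hq0, ?_, ?_⟩
      · simp only [Matrix.cons_val_one, Matrix.cons_val_fin_one]
        linarith
      · simp only [Matrix.cons_val_one, Matrix.cons_val_zero, Matrix.cons_val_fin_one]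
        linarith
    · show (![q 0, q 1 + f (q 0)] : Fin 2 → ℝ) ∉ r₁.domain
      rw [hr₁]
      rintro ⟨-, -, h⟩
      simp only [Matrix.cons_val_one, Matrix.cons_val_zero, Matrix.cons_val_fin_one] at h
      linarith
    · ext i
      fin_cases i <;> simp
  let rN : KZ.IntegralRep 2 := r'.restrict (r'.domain \ r₂.domain)
    (r'.isSemialgebraic_domain.diff r₂.isSemialgebraic_domain) sdiff_subset
  have hrNi : ∀ p ∈ rN.domain, rN.integrand p = 1 := fun q _ => hr'i q
  have hx₃ : KZ.of r' - KZ.of r₂ - KZ.of rN ∈ KZ.domainAddRel :=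
    sub_sub_restrict_diff_mem_domainAddRel r' r₂ h₂sub fun q hq => by rw [hr'i, hr₂i q hq]
  -- Step 4 (1a): `N ⊆ {y = 0}` is null
  have hNsub : rN.domain ⊆ {q : Fin 2 → ℝ | q 1 = 0} := by
    rintro q ⟨hq, hq₂⟩
    rw [hr'd] at hq
    obtain ⟨p, ⟨hp, hp₁⟩, rfl⟩ := hq
    have hp' : p ∈ r.domain := hp
    rw [hr] at hp'
    obtain ⟨hp0, hp1, hp2⟩ := hp'
    have hp₁' : p ∉ r₁.domain := hp₁
    rw [hr₁] at hp₁'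
    rw [hr₂] at hq₂
    simp only [mem_setOf_eq, Matrix.cons_val_zero, Matrix.cons_val_one,
      Matrix.cons_val_fin_one] at hp₁' hq₂ ⊢
    have hle : f (p 0) ≤ p 1 := by
      by_contra h
      exact hp₁' ⟨hp0, hp1, lt_of_not_ge h⟩
    have hle' : p 1 - f (p 0) ≤ 0 := by
      by_contra h
      exact hq₂ ⟨hp0, lt_of_not_ge h, by linarith⟩
    linarith
  have hN0 : volume rN.domain = 0 := measure_mono_null hNsub volume_setOf_apply_one_eq_zero
  have hx₄ : KZ.of rN - KZ.of rN - KZ.of rN ∈ KZ.domainAddRel :=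
    sub_self_sub_self_mem_domainAddRel rN hN0
  -- assemble the chain
  have heq : KZ.of r - KZ.of r₁ - KZ.of r₂ =
      (KZ.of r - KZ.of r₁ - KZ.of rB) + (KZ.of rB - KZ.of r') + (KZ.of r' - KZ.of r₂ - KZ.of rN) -
        (KZ.of rN - KZ.of rN - KZ.of rN) := by
    abel
  rw [heq]
  have hr'i' : ∀ p ∈ r'.domain, r'.integrand p = 1 := fun q _ => hr'i q
  refine sub_mem (add_mem (add_mem (hG _ (Or.inl hx₁) ?_) (hG _ (Or.inr hx₂) ?_))
    (hG _ (Or.inl hx₃) ?_)) (hG _ (Or.inl hx₄) ?_)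
  · exact sub_mem (sub_mem (hH r hri) (hH r₁ hr₁i)) (hH rB hrBi)
  · exact sub_mem (hH rB hrBi) (hH r' hr'i')
  · exact sub_mem (sub_mem (hH r' hr'i') (hH r₂ hr₂i)) (hH rN hrNi)
  · exact sub_mem (sub_mem (hH rN hrNi) (hH rN hrNi)) (hH rN hrNi)

end Summit.KontsevichZagierPeriods.SymplecticScissors.StackingShear
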